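import Summits.CriticalPhenomena.PercolationContinuityZ3.Theorems.FK.SubcriticalEdgeCovariance
import HarnessLib

/-!
# THE VARIANCE OF THE NUMBER OF OPEN EDGES OF A BOX IS LINEAR IN THE VOLUME BELOW `p_c(q)`, and the quantitative law
# of large numbers `φ^b_{p,q}(|S_n/(d|Λ_n|) − h^b(p,q)| ≥ ε) ≤ K/(ε² d² |Λ_n|)` for the open-edge density

Claimed R42 (8)(c) in the cell INBOX at 2026-08-28T11:02:16Z by fkp-10a gen 353 (NEW CLAIM #2 of the gen), addressed to coordinator fk-4 g272 (seated 09:59Z 2026-08-28 by l.8334; R149 l.8335: row FO-10a-g353 [g272, R149] = package g353-weakmixing; its clause «consequences beyond reformulation = a NEW R42 (8)(c) claim, R150»); lineage row FO-10a-g353c (self-suggested), package g353-covdecay, label CV-B.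
Helper file of the `fk-continuity` build cell (bschramm lane; `--supports stmt-CriticalPhenomena-4575`); builds on
p205010 (kernel theorem, internal audit signed; external expert review pending). No definitions, no named facts, no
sorries; standard axioms. UNCONDITIONAL.

`SubcriticalEdgeCovariance.lean` bounds the double covariance sum of the coordinate-edge indicators over `Λ_n × [d]`
by `K · |Λ_n|` for the box limits `φ^b_{p,q}`, `p < p_c(q)`. Writing the number of open coordinate edges based in `Λ_n`
as `S_n = Σ_{(x,i) ∈ Λ_n × [d]} 1{⟨x, x+e_i⟩ open}` (the lineage's count of `EdgeDensityLLN.lean`, which squeezes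
`|ω ∩ E_{Λ_n}|` between `S_{n−1}` and `S_n`), its mean is `d |Λ_n| h^b` with `h^b = φ^b_{p,q}(e open)` the edge density
(Grimmett (4.61); `rcLimit_real_setOf_mem_eq_of_mem_edgeSet`), and its variance is that double sum:

* `integral_sum_indicator_sub_sq_eq` — `∫ (Σ_a (1_{A_a} − P(A_a)))² dP = Σ_{a,a'} (P(A_a ∩ A_{a'}) − P(A_a)P(A_{a'}))`
  for finitely many events under a probability measure (bilinearity);
* `exists_variance_coordEdgeCount_le_mul_card_box` — **`∫ (S_n − d|Λ_n|h^b)² dφ^b_{p,q} ≤ K · |Λ_n|`** for all `n`, both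
  `b` (`d ≥ 2`, `q ≥ 1`, `0 ≤ p < p_c(q)`; one `K = K(p,q,d)`);
* `exists_real_le_abs_coordEdgeCount_sub_le_div` — **Chebyshev: `φ^b_{p,q}(t ≤ |S_n − d|Λ_n|h^b|) ≤ K|Λ_n|/t²`**, in
  particular (`exists_real_le_abs_coordEdgeDensity_sub_le_div`) `φ^b_{p,q}(ε ≤ |S_n/(d|Λ_n|) − h^b|) ≤ K/(ε² d² |Λ_n|)`:
  the open-edge density of `Λ_n` concentrates at `h^b(p,q)` at rate `|Λ_n|^{-1}` — the quantitative (`L²`) form, below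
  `p_c(q)`, of the lineage's ergodic law of large numbers `tendsto_rcLimit_real_le_abs_openEdges_div_card_box_sub`.

## References

* G. Grimmett, *The Random-Cluster Model*, Springer 2006: §2.5 (2.45)–(2.47), §4.5 (4.61), Cor. (4.23). [Grimmett2006]
* K. S. Alexander, *On weak mixing in lattice models*, PTRF 110 (1998) 441–471, (1.1). [Alexander1998]
* H. Duminil-Copin, A. Raoufi, V. Tassion, Ann. of Math. 189 (2019), Thm. 1.2 (1). [DuminilCopinRaoufiTassion2019]
-/

noncomputable section

namespace Summit.CriticalPhenomena.PercolationContinuityZ3.Theorems.FK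

namespace BoundaryInfluence

open MeasureTheory Finset
open Literature.Probability.Percolation Literature.Probability.LatticeModels Literature.Barriers.CriticalPhenomena
open Literature.Probability.Percolation.OneArmOSSS Literature.Probability.Percolation.DCT16 MonotonicOSSS

variable {d : ℕ} {p q : ℝ}

/-- A centred finite sum of indicators is bounded by the number of terms. [folklore] -/
theorem abs_sum_indicator_sub_le_card {Ω ι : Type*} [MeasurableSpace Ω] (P : Measure Ω) [IsProbabilityMeasure P]
    (s : Finset ι) (A : ι → Set Ω) (ω : Ω) :
    |∑ a ∈ s, ((A a).indicator (1 : Ω → ℝ) ω - P.real (A a))| ≤ #s := by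
  refine (Finset.abs_sum_le_sum_abs _ _).trans ?_
  have h : ∀ a ∈ s, |(A a).indicator (1 : Ω → ℝ) ω - P.real (A a)| ≤ 1 := by
    intro a _
    have h1 : 0 ≤ (A a).indicator (1 : Ω → ℝ) ω ∧ (A a).indicator (1 : Ω → ℝ) ω ≤ 1 := by
      by_cases hω : ω ∈ A a
      · rw [Set.indicator_of_mem hω, Pi.one_apply]; exact ⟨zero_le_one, le_rfl⟩
      · rw [Set.indicator_of_notMem hω]; exact ⟨le_rfl, zero_le_one⟩
    have h2 : 0 ≤ P.real (A a) := measureReal_nonneg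
    have h3 : P.real (A a) ≤ 1 := measureReal_le_one
    rw [abs_le]; constructor <;> linarith [h1.1, h1.2]
  refine (Finset.sum_le_sum h).trans ?_
  rw [Finset.sum_const, nsmul_eq_mul, mul_one]

/-! ### The variance of a finite sum of indicators -/

section Variance

variable {Ω ι : Type*} [MeasurableSpace Ω] (P : Measure Ω) [IsProbabilityMeasure P]

/-- `∫ (1_A − P(A))(1_B − P(B)) dP = P(A ∩ B) − P(A)P(B)` (the covariance of two indicators). [cite: Grimmett2006, §2.5 (2.45)] -/
theorem integral_indicator_sub_mul_indicator_sub {A B : Set Ω} (hA : MeasurableSet A) (hB : MeasurableSet B) :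
    ∫ ω, (A.indicator (1 : Ω → ℝ) ω - P.real A) * (B.indicator (1 : Ω → ℝ) ω - P.real B) ∂P =
      P.real (A ∩ B) - P.real A * P.real B := by
  have hprod : ∀ (A B : Set Ω) (ω : Ω),
      A.indicator (1 : Ω → ℝ) ω * B.indicator (1 : Ω → ℝ) ω = (A ∩ B).indicator (1 : Ω → ℝ) ω := by
    intro A B ω
    by_cases hA : ω ∈ A
    · by_cases hB : ω ∈ B
      · rw [Set.indicator_of_mem hA, Set.indicator_of_mem hB, Set.indicator_of_mem (Set.mem_inter hA hB), Pi.one_apply,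
          mul_one]
      · rw [Set.indicator_of_notMem hB, Set.indicator_of_notMem (fun h : ω ∈ A ∩ B => hB h.2), mul_zero]
    · rw [Set.indicator_of_notMem hA, Set.indicator_of_notMem (fun h : ω ∈ A ∩ B => hA h.1), zero_mul]
  have hiA : Integrable (fun ω => A.indicator (1 : Ω → ℝ) ω) P := (integrable_const (1 : ℝ)).indicator hA
  have hiB : Integrable (fun ω => B.indicator (1 : Ω → ℝ) ω) P := (integrable_const (1 : ℝ)).indicator hB
  have hiAB : Integrable (fun ω => (A ∩ B).indicator (1 : Ω → ℝ) ω) P := (integrable_const (1 : ℝ)).indicator (hA.inter hB)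
  have hexp : (fun ω => (A.indicator (1 : Ω → ℝ) ω - P.real A) * (B.indicator (1 : Ω → ℝ) ω - P.real B)) =
      fun ω => ((A ∩ B).indicator (1 : Ω → ℝ) ω - P.real B * A.indicator (1 : Ω → ℝ) ω) -
        (P.real A * B.indicator (1 : Ω → ℝ) ω - P.real A * P.real B) := by
    funext ω; rw [← hprod]; ring
  have h1 : Integrable (fun ω => (A ∩ B).indicator (1 : Ω → ℝ) ω - P.real B * A.indicator (1 : Ω → ℝ) ω) P :=
    hiAB.sub (hiA.const_mul _)
  have h2 : Integrable (fun ω => P.real A * B.indicator (1 : Ω → ℝ) ω - P.real A * P.real B) P :=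
    (hiB.const_mul _).sub (integrable_const _)
  rw [hexp, integral_sub h1 h2, integral_sub hiAB (hiA.const_mul _), integral_sub (hiB.const_mul _) (integrable_const _),
    integral_const_mul, integral_const_mul, integral_indicator_one (hA.inter hB), integral_indicator_one hA,
    integral_indicator_one hB, integral_const, smul_eq_mul, probReal_univ, one_mul]
  ring

/-- **The variance of a finite sum of indicators is the double sum of the covariances**:
`∫ (Σ_{a∈s} (1_{A_a} − P(A_a)))² dP = Σ_{a,a' ∈ s} (P(A_a ∩ A_{a'}) − P(A_a)·P(A_{a'}))`.
[cite: Grimmett2006, §2.5 (2.45)–(2.47)] -/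
theorem integral_sum_indicator_sub_sq_eq (s : Finset ι) (A : ι → Set Ω) (hA : ∀ a, MeasurableSet (A a)) :
    ∫ ω, (∑ a ∈ s, ((A a).indicator (1 : Ω → ℝ) ω - P.real (A a))) ^ 2 ∂P =
      ∑ a ∈ s, ∑ a' ∈ s, (P.real (A a ∩ A a') - P.real (A a) * P.real (A a')) := by
  have hint : ∀ a a', Integrable (fun ω => ((A a).indicator (1 : Ω → ℝ) ω - P.real (A a)) *
      ((A a').indicator (1 : Ω → ℝ) ω - P.real (A a'))) P := by
    intro a a'
    have h1 : Integrable (fun ω => (A a).indicator (1 : Ω → ℝ) ω - P.real (A a)) P :=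
      ((integrable_const (1 : ℝ)).indicator (hA a)).sub (integrable_const _)
    have h2 : Integrable (fun ω => (A a').indicator (1 : Ω → ℝ) ω - P.real (A a')) P :=
      ((integrable_const (1 : ℝ)).indicator (hA a')).sub (integrable_const _)
    have hb : ∀ ω, ‖(A a).indicator (1 : Ω → ℝ) ω - P.real (A a)‖ ≤ 1 := fun ω => by
      rw [Real.norm_eq_abs]
      have := abs_sum_indicator_sub_le_card P {a} A ω
      rwa [Finset.sum_singleton, Finset.card_singleton, Nat.cast_one] at this
    exact h2.bdd_mul h1.aestronglyMeasurable (ae_of_all _ hb)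
  simp_rw [sq, Finset.sum_mul_sum]
  rw [integral_finsetSum _ fun a _ => integrable_finsetSum _ fun a' _ => hint a a']
  refine Finset.sum_congr rfl fun a _ => ?_
  rw [integral_finsetSum _ fun a' _ => hint a a']
  exact Finset.sum_congr rfl fun a' _ => integral_indicator_sub_mul_indicator_sub P (hA a) (hA a')

end Variance

/-! ### The variance of the coordinate-edge count below `p_c(q)` -/

section FK

/-- **`Var_{φ^b_{p,q}}(S_n) ≤ K · |Λ_n|` below `p_c(q)`**: for `d ≥ 2`, `q ≥ 1`, `0 ≤ p < p_c(q)` there is `K > 0` such that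
for both `b` and all `n`,
`∫ (Σ_{(x,i) ∈ Λ_n × [d]} (1{⟨x,x+e_i⟩ open} − φ^b(⟨x,x+e_i⟩ open)))² dφ^b_{p,q} ≤ K · |Λ_n|`.
[cite: Grimmett2006, §2.5 (2.45)–(2.47); Alexander1998, (1.1); DuminilCopinRaoufiTassion2019, Thm. 1.2 (1)] -/
theorem exists_variance_coordEdgeCount_le_mul_card_box (hd : 2 ≤ d) (hq : 1 ≤ q) (hp0 : 0 ≤ p) (hpc : p < rcCriticalProb d q) :
    ∃ K : ℝ, 0 < K ∧ ∀ (b : Bool) (n : ℕ),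
      ∫ ω, (∑ xi ∈ box d n ×ˢ (Finset.univ : Finset (Fin d)),
          (({ω' : BondConfig (Site d) | s(xi.1, xi.1 + Pi.single xi.2 1) ∈ ω'}).indicator (1 : BondConfig (Site d) → ℝ) ω -
            (rcLimit d b p q).real {ω' | s(xi.1, xi.1 + Pi.single xi.2 1) ∈ ω'})) ^ 2 ∂(rcLimit d b p q) ≤ K * #(box d n) := by
  obtain ⟨K, hK, hsum⟩ := exists_sum_sum_edgeCov_le_mul_card_box hd hq hp0 hpc
  refine ⟨K, hK, fun b n => ?_⟩
  haveI := isProbabilityMeasure_rcLimit (d := d) b p q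
  rw [integral_sum_indicator_sub_sq_eq (rcLimit d b p q) _ _ fun xi =>
    measurableSet_of_isLocalEvent_holds (isLocalEvent_setOf_mem _)]
  refine le_trans (Finset.sum_le_sum fun a _ => Finset.sum_le_sum fun a' _ => le_abs_self _) ?_
  rw [Finset.sum_product]
  refine le_trans (Finset.sum_le_sum fun x _ => Finset.sum_le_sum fun i _ => le_of_eq (Finset.sum_product _ _ _)) ?_
  exact hsum b n

/-- **The mean of the coordinate-edge count is `d · |Λ_n| · h^b(p,q)`**: all lattice edges have the same density
`h^b = φ^b_{p,q}(e₀ open)`. [cite: Grimmett2006, (4.61)] -/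
theorem sum_rcLimit_real_coordEdge_eq (b : Bool) (hp : p ∈ Set.Icc (0 : ℝ) 1) (hq : 1 ≤ q) {e₀ : Sym2 (Site d)}
    (he₀ : e₀ ∈ (zdGraph d).edgeSet) (n : ℕ) :
    ∑ xi ∈ box d n ×ˢ (Finset.univ : Finset (Fin d)), (rcLimit d b p q).real {ω' | s(xi.1, xi.1 + Pi.single xi.2 1) ∈ ω'} =
      d * #(box d n) * (rcLimit d b p q).real {ω | e₀ ∈ ω} := by
  rw [Finset.sum_congr rfl fun xi _ => rcLimit_real_setOf_mem_eq_of_mem_edgeSet b hp hq (coordEdge_mem_edgeSet xi.1 xi.2) he₀,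
    Finset.sum_const, Finset.card_product, Finset.card_univ, Fintype.card_fin, nsmul_eq_mul]
  push_cast; ring

/-- **Chebyshev below `p_c(q)`: `φ^b_{p,q}(t ≤ |S_n − d|Λ_n|h^b|) ≤ K·|Λ_n|/t²`** for `t > 0`, where
`S_n = #{(x,i) ∈ Λ_n × [d] : ⟨x, x+e_i⟩ open}` and `h^b = φ^b_{p,q}(e₀ open)` (`d ≥ 2`, `q ≥ 1`, `0 ≤ p < p_c(q)`).
[cite: Grimmett2006, §2.5 (2.45)–(2.47) and Cor. (4.23); Alexander1998, (1.1)] -/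
theorem exists_real_le_abs_coordEdgeCount_sub_le_div (hd : 2 ≤ d) (hq : 1 ≤ q) (hp0 : 0 ≤ p) (hpc : p < rcCriticalProb d q)
    {e₀ : Sym2 (Site d)} (he₀ : e₀ ∈ (zdGraph d).edgeSet) :
    ∃ K : ℝ, 0 < K ∧ ∀ (b : Bool) (n : ℕ) {t : ℝ}, 0 < t →
      (rcLimit d b p q).real {ω | t ≤ |(∑ xi ∈ box d n ×ˢ (Finset.univ : Finset (Fin d)),
          ({ω' : BondConfig (Site d) | s(xi.1, xi.1 + Pi.single xi.2 1) ∈ ω'}).indicator (1 : BondConfig (Site d) → ℝ) ω) -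
            d * #(box d n) * (rcLimit d b p q).real {ω | e₀ ∈ ω}|} ≤ K * #(box d n) / t ^ 2 := by
  have hp : p ∈ Set.Icc (0 : ℝ) 1 := ⟨hp0, (hpc.trans (rcCriticalProb_lt_one hd hq)).le⟩
  obtain ⟨K, hK, hvar⟩ := exists_variance_coordEdgeCount_le_mul_card_box hd hq hp0 hpc
  refine ⟨K, hK, fun b n t ht => ?_⟩
  set P : Measure (BondConfig (Site d)) := rcLimit d b p q with hPdef
  haveI : IsProbabilityMeasure P := isProbabilityMeasure_rcLimit (d := d) b p q
  set s : Finset (Site d × Fin d) := box d n ×ˢ (Finset.univ : Finset (Fin d)) with hs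
  set A : Site d × Fin d → Set (BondConfig (Site d)) := fun xi => {ω' | s(xi.1, xi.1 + Pi.single xi.2 1) ∈ ω'} with hA
  have hAm : ∀ xi, MeasurableSet (A xi) := fun xi => measurableSet_of_isLocalEvent_holds (isLocalEvent_setOf_mem _)
  -- the centred sum `g = S_n − d|Λ_n|h`
  set g : BondConfig (Site d) → ℝ := fun ω => ∑ xi ∈ s, ((A xi).indicator (1 : BondConfig (Site d) → ℝ) ω - P.real (A xi)) with hg
  have hg_eq : ∀ ω, (∑ xi ∈ s, (A xi).indicator (1 : BondConfig (Site d) → ℝ) ω) - d * #(box d n) * P.real {ω | e₀ ∈ ω} = g ω := by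
    intro ω
    simp only [hg, hs, hA, hPdef, Finset.sum_sub_distrib, sum_rcLimit_real_coordEdge_eq b hp hq he₀ n]
  have hgi : Integrable g P := integrable_finsetSum _ fun xi _ =>
    (((integrable_const (1 : ℝ)).indicator (hAm xi)).sub (integrable_const _))
  have hgb : ∀ ω, ‖g ω‖ ≤ #s := fun ω => by
    rw [Real.norm_eq_abs]; exact abs_sum_indicator_sub_le_card P s A ω
  have hg2i : Integrable (fun ω => g ω * g ω) P := hgi.bdd_mul hgi.aestronglyMeasurable (ae_of_all _ hgb)
  have hvar' : ∫ ω, g ω * g ω ∂P ≤ K * #(box d n) := by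
    have := hvar b n
    simp_rw [sq] at this
    exact this
  -- Markov on `g²`
  have hmarkov := mul_meas_ge_le_integral_of_nonneg (ae_of_all _ fun ω => mul_self_nonneg (g ω)) hg2i (t ^ 2)
  have hset : {ω | t ≤ |(∑ xi ∈ s, (A xi).indicator (1 : BondConfig (Site d) → ℝ) ω) - d * #(box d n) * P.real {ω | e₀ ∈ ω}|} =
      {ω | t ^ 2 ≤ g ω * g ω} := by
    ext ω
    simp only [Set.mem_setOf_eq]
    rw [hg_eq ω, ← sq, ← sq_abs (g ω)]
    exact (sq_le_sq₀ ht.le (abs_nonneg _)).symm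
  rw [hset, le_div_iff₀ (by positivity)]
  calc P.real {ω | t ^ 2 ≤ g ω * g ω} * t ^ 2 = t ^ 2 * P.real {ω | t ^ 2 ≤ g ω * g ω} := mul_comm _ _
    _ ≤ ∫ ω, g ω * g ω ∂P := hmarkov
    _ ≤ K * #(box d n) := hvar'

/-- **QUANTITATIVE LAW OF LARGE NUMBERS FOR THE OPEN-EDGE DENSITY BELOW `p_c(q)`**:
`φ^b_{p,q}(ε ≤ |S_n/(d|Λ_n|) − h^b(p,q)|) ≤ K/(ε² d² |Λ_n|)` for `ε > 0`, all `n`, both `b` (`d ≥ 2`, `q ≥ 1`,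
`0 ≤ p < p_c(q)`): the density of open coordinate edges of `Λ_n` concentrates at the edge density at rate `|Λ_n|^{-1}`
(the `L²` strengthening, below `p_c`, of the lineage's ergodic `tendsto_rcLimit_real_le_abs_openEdges_div_card_box_sub`).
[cite: Grimmett2006, Cor. (4.23) with (4.61); Alexander1998, (1.1); DuminilCopinRaoufiTassion2019, Thm. 1.2 (1)] -/
theorem exists_real_le_abs_coordEdgeDensity_sub_le_div (hd : 2 ≤ d) (hq : 1 ≤ q) (hp0 : 0 ≤ p) (hpc : p < rcCriticalProb d q)
    {e₀ : Sym2 (Site d)} (he₀ : e₀ ∈ (zdGraph d).edgeSet) :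
    ∃ K : ℝ, 0 < K ∧ ∀ (b : Bool) (n : ℕ) {ε : ℝ}, 0 < ε →
      (rcLimit d b p q).real {ω | ε ≤ |(∑ xi ∈ box d n ×ˢ (Finset.univ : Finset (Fin d)),
          ({ω' : BondConfig (Site d) | s(xi.1, xi.1 + Pi.single xi.2 1) ∈ ω'}).indicator (1 : BondConfig (Site d) → ℝ) ω) /
            (d * #(box d n)) - (rcLimit d b p q).real {ω | e₀ ∈ ω}|} ≤ K / (ε ^ 2 * d ^ 2 * #(box d n)) := by
  obtain ⟨K, hK, h⟩ := exists_real_le_abs_coordEdgeCount_sub_le_div hd hq hp0 hpc he₀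
  refine ⟨K, hK, fun b n ε hε => ?_⟩
  have hd0 : (0 : ℝ) < d := by exact_mod_cast (show 0 < d by omega)
  have hbox : (0 : ℝ) < #(box d n) := by exact_mod_cast Finset.card_pos.2 (box_nonempty d n)
  have hD : (0 : ℝ) < d * #(box d n) := mul_pos hd0 hbox
  have hset : {ω : BondConfig (Site d) | ε ≤ |(∑ xi ∈ box d n ×ˢ (Finset.univ : Finset (Fin d)),
      ({ω' : BondConfig (Site d) | s(xi.1, xi.1 + Pi.single xi.2 1) ∈ ω'}).indicator (1 : BondConfig (Site d) → ℝ) ω) /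
        (d * #(box d n)) - (rcLimit d b p q).real {ω | e₀ ∈ ω}|} =
      {ω | ε * (d * #(box d n)) ≤ |(∑ xi ∈ box d n ×ˢ (Finset.univ : Finset (Fin d)),
        ({ω' : BondConfig (Site d) | s(xi.1, xi.1 + Pi.single xi.2 1) ∈ ω'}).indicator (1 : BondConfig (Site d) → ℝ) ω) -
          d * #(box d n) * (rcLimit d b p q).real {ω | e₀ ∈ ω}|} := by
    ext ω
    simp only [Set.mem_setOf_eq]
    rw [show (∑ xi ∈ box d n ×ˢ (Finset.univ : Finset (Fin d)),
        ({ω' : BondConfig (Site d) | s(xi.1, xi.1 + Pi.single xi.2 1) ∈ ω'}).indicator (1 : BondConfig (Site d) → ℝ) ω) /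
          (d * #(box d n)) - (rcLimit d b p q).real {ω | e₀ ∈ ω} =
        ((∑ xi ∈ box d n ×ˢ (Finset.univ : Finset (Fin d)),
          ({ω' : BondConfig (Site d) | s(xi.1, xi.1 + Pi.single xi.2 1) ∈ ω'}).indicator (1 : BondConfig (Site d) → ℝ) ω) -
            d * #(box d n) * (rcLimit d b p q).real {ω | e₀ ∈ ω}) / (d * #(box d n)) by field_simp,
      abs_div, abs_of_pos hD, le_div_iff₀ hD]
  rw [hset]
  refine (h b n (mul_pos hε hD)).trans (le_of_eq ?_)
  field_simp

end FK

end BoundaryInfluence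

end Summit.CriticalPhenomena.PercolationContinuityZ3.Theorems.FK

end
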